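import Summits.AnomalousDissipation.AnomalousDissipation.Theorems.TaylorCertificatesFloorCertificateStubMinimaxAlternative
import Summits.AnomalousDissipation.AnomalousDissipation.Theorems.TaylorCertificatesFloorCertificateStubLscEnstrophy
import Summits.AnomalousDissipation.AnomalousDissipation.Theorems.TaylorCertificatesFloorCertificateStubFanMinimax
import Summits.AnomalousDissipation.AnomalousDissipation.Theorems.TaylorCertificatesFloorCertificateStubCylindricalCombination
import HarnessLib

/-!
# Stub `stub_minimaxAlternativeOn` (S1b) of line `registered`, crux `PumpedMirror.MirrorFloorTG`
# (stmt-AnomalousDissipation-15372)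

THE MINIMAX ALTERNATIVE WITH SLOPE-BOUNDED MULTIPLIERS ON A CARRIER `S ∩ {|u|² ≤ ρ}` — strong duality in
mean form on a dissipation sublevel set, tail included. This is the sibling crux FloorCertificate's
`stub_minimaxAlternative` re-run on the game set
`X_S = {μ : μ-a.e. |u|² ≤ ρ, μ-a.e. u ∈ S, ∫⁻‖∇u‖² ≤ C}` (an arbitrary carrier `S ⊆ H`, a free radius
`ρ`), whose compactness for finite `C` is the hypothesis (it is S1a `stub_sublevelCompactOn` for closed
`S`), with Ky Fan's principle (`stub_fanMinimax`), the lower semicontinuity of the mean enstrophy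
(`stub_lscEnstrophy`) and the cylindrical combinations (`stub_cylindricalCombination`) now LANDED and
imported instead of assumed.

At fixed `(f, ν)`, radius `ρ`, slope `L ≥ 0`, level `γ` and slack `η > 0`: EITHER some multiplier `(Φ, θ)`
with `−L ≤ θ ≤ 0` and `|⟨F(u),Φ'(u)⟩| ≤ L` on the ball certifies the floor `γ − η` at EVERY
finite-enstrophy state of `S ∩ ball`, OR an `(L, γ + η)`-approximately relaxed statistic carried by
`S ∩ ball` exists.

Proof (on top of `…TaylorCertificatesFloorCertificateStubMinimaxAlternative(Tools)`): `fan_convex_on`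
(mixtures stay in `X_S`: `ae_mix` for the extra conjunct; the Lagrangian is affine),
`lagrangian_lowerSemicontinuous_on` (the sibling's lsc composed with the inclusion `X_S ↪ X`),
`fan_concave` verbatim (it quantifies over all ball-carried finite measures), `fan_game_on` (Ky Fan on
`X_S × Y_L`), `alternative_on_sublevel_on`; the stub takes `C = c/ν`,
`c = L(1 + 2√ρ‖f‖) + |γ| + η + 1`, `M = γ + η`, and closes the first horn by Dirac masses at
`u ∈ S ∩ ball` (`ν‖∇u‖² ≤ c`) and the tail estimate (`ν‖∇u‖² > c`).
References: Ky Fan, *Minimax theorems*, PNAS 39 (1953) 42–47, Thm 2; Foias–Manley–Rosa–Temam (2001),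
Ch. IV §1.2.
-/

noncomputable section

set_option linter.dupNamespace false

namespace Summit.AnomalousDissipation.AnomalousDissipation.Theorems.PumpedMirrorMirrorFloorTG

open MeasureTheory Filter Topology UnitAddTorus
open scoped InnerProductSpace ENNReal NNReal BoundedContinuousFunction
open Literature.Analysis.FunctionSpaces Literature.Analysis.FluidPDE
open Summit.AnomalousDissipation.AnomalousDissipation.Theorems.TaylorCertificatesFloorCertificate

/-! ## Ky Fan's hypotheses (i), (ii) on the constrained game set and the game -/

/-- **Convex-likeness in the measure on `X_S`**: the mixture `t μ₁ + (1 − t) μ₂` of two probability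
measures carried by `S ∩ ball` with mean enstrophy `≤ C` is again such a measure, and the Lagrangian is
AFFINE along it (hypothesis (ii) of Fan 1953, Thm 2). [folklore] -/
theorem fan_convex_on {ν : ℝ} {f : UnitAddTorus (Fin 3) → EuclideanSpace ℝ (Fin 3)}
    (hf : MemLp f 2 volume) (S : Set (Torus.energySpace (Fin 3))) (ρ : ℝ) {C : ℝ≥0∞} (hC : C ≠ ⊤)
    (μ₁ μ₂ : ProbabilityMeasure (Torus.energySpace (Fin 3)))
    (h₁ : (∀ᵐ u ∂(μ₁ : Measure (Torus.energySpace (Fin 3))), ‖u‖ ^ 2 ≤ ρ) ∧ (∀ᵐ u ∂(μ₁ : Measure (Torus.energySpace (Fin 3))), u ∈ S) ∧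
      Torus.ensembleEnstrophy (μ₁ : Measure (Torus.energySpace (Fin 3))) ≤ C)
    (h₂ : (∀ᵐ u ∂(μ₂ : Measure (Torus.energySpace (Fin 3))), ‖u‖ ^ 2 ≤ ρ) ∧ (∀ᵐ u ∂(μ₂ : Measure (Torus.energySpace (Fin 3))), u ∈ S) ∧
      Torus.ensembleEnstrophy (μ₂ : Measure (Torus.energySpace (Fin 3))) ≤ C)
    {t : ℝ} (ht0 : 0 ≤ t) (ht1 : t ≤ 1) :
    ∃ μ₀ : ProbabilityMeasure (Torus.energySpace (Fin 3)),
      ((∀ᵐ u ∂(μ₀ : Measure (Torus.energySpace (Fin 3))), ‖u‖ ^ 2 ≤ ρ) ∧ (∀ᵐ u ∂(μ₀ : Measure (Torus.energySpace (Fin 3))), u ∈ S) ∧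
        Torus.ensembleEnstrophy (μ₀ : Measure (Torus.energySpace (Fin 3))) ≤ C) ∧
      ∀ (Φ : Torus.CylindricalTest (Fin 3)) (θ : ℝ),
        Torus.ensembleDissipation ν (μ₀ : Measure (Torus.energySpace (Fin 3))) +
            ∫ u, Torus.nsGeneratorPairing ν f u (Φ.grad u) ∂(μ₀ : Measure (Torus.energySpace (Fin 3))) +
            2 * θ * ((∫ u, Torus.pairing u.1 f ∂(μ₀ : Measure (Torus.energySpace (Fin 3)))) -
              Torus.ensembleDissipation ν (μ₀ : Measure (Torus.energySpace (Fin 3)))) =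
          t * (Torus.ensembleDissipation ν (μ₁ : Measure (Torus.energySpace (Fin 3))) +
            ∫ u, Torus.nsGeneratorPairing ν f u (Φ.grad u) ∂(μ₁ : Measure (Torus.energySpace (Fin 3))) +
            2 * θ * ((∫ u, Torus.pairing u.1 f ∂(μ₁ : Measure (Torus.energySpace (Fin 3)))) -
              Torus.ensembleDissipation ν (μ₁ : Measure (Torus.energySpace (Fin 3))))) +
          (1 - t) * (Torus.ensembleDissipation ν (μ₂ : Measure (Torus.energySpace (Fin 3))) +
            ∫ u, Torus.nsGeneratorPairing ν f u (Φ.grad u) ∂(μ₂ : Measure (Torus.energySpace (Fin 3))) +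
            2 * θ * ((∫ u, Torus.pairing u.1 f ∂(μ₂ : Measure (Torus.energySpace (Fin 3)))) -
              Torus.ensembleDissipation ν (μ₂ : Measure (Torus.energySpace (Fin 3))))) := by
  set m : Measure (Torus.energySpace (Fin 3)) := ENNReal.ofReal t • (μ₁ : Measure (Torus.energySpace (Fin 3))) +
    ENNReal.ofReal (1 - t) • (μ₂ : Measure (Torus.energySpace (Fin 3))) with hm
  have hprob : IsProbabilityMeasure m := isProbabilityMeasure_mix _ _ ht0 ht1
  have hae : ∀ᵐ u ∂m, ‖u‖ ^ 2 ≤ ρ := ae_mix _ _ h₁.1 h₂.1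
  have haeS : ∀ᵐ u ∂m, u ∈ S := ae_mix _ _ h₁.2.1 h₂.2.1
  have hE : Torus.ensembleEnstrophy m =
      ENNReal.ofReal t * Torus.ensembleEnstrophy (μ₁ : Measure (Torus.energySpace (Fin 3))) +
        ENNReal.ofReal (1 - t) * Torus.ensembleEnstrophy (μ₂ : Measure (Torus.energySpace (Fin 3))) :=
    lintegral_mix _ _ _ _ _
  have hE₁ : Torus.ensembleEnstrophy (μ₁ : Measure (Torus.energySpace (Fin 3))) ≠ ⊤ := ne_top_of_le_ne_top hC h₁.2.2
  have hE₂ : Torus.ensembleEnstrophy (μ₂ : Measure (Torus.energySpace (Fin 3))) ≠ ⊤ := ne_top_of_le_ne_top hC h₂.2.2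
  refine ⟨⟨m, hprob⟩, ⟨hae, haeS, ?_⟩, fun Φ θ => ?_⟩
  · rw [ProbabilityMeasure.coe_mk, hE]
    exact mix_le ht0 ht1 h₁.2.2 h₂.2.2
  · obtain ⟨K, hK⟩ := abs_nsGeneratorPairing_grad_growth ν hf Φ
    have hcg := Torus.continuous_nsGeneratorPairing_grad ν (hf.integrable one_le_two) Φ
    have hG : ∫ u, Torus.nsGeneratorPairing ν f u (Φ.grad u) ∂m =
        t * ∫ u, Torus.nsGeneratorPairing ν f u (Φ.grad u) ∂(μ₁ : Measure (Torus.energySpace (Fin 3))) +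
          (1 - t) * ∫ u, Torus.nsGeneratorPairing ν f u (Φ.grad u) ∂(μ₂ : Measure (Torus.energySpace (Fin 3))) :=
      integral_mix _ _ ht0 ht1 (integrable_of_ball hcg hK _ h₁.1) (integrable_of_ball hcg hK _ h₂.1)
    have hW : ∫ u, Torus.pairing u.1 f ∂m =
        t * ∫ u, Torus.pairing u.1 f ∂(μ₁ : Measure (Torus.energySpace (Fin 3))) +
          (1 - t) * ∫ u, Torus.pairing u.1 f ∂(μ₂ : Measure (Torus.energySpace (Fin 3))) :=
      integral_mix _ _ ht0 ht1
        (integrable_of_ball (Torus.continuous_pairing_coe hf) (abs_pairing_growth hf) _ h₁.1)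
        (integrable_of_ball (Torus.continuous_pairing_coe hf) (abs_pairing_growth hf) _ h₂.1)
    simp only [ProbabilityMeasure.coe_mk, Torus.ensembleDissipation]
    rw [hE, toReal_mix ht0 ht1 hE₁ hE₂, hG, hW]
    ring

/-- **Lower semicontinuity in the measure on `X_S`.** For a fixed multiplier `(Φ, θ)` with `θ ≤ 0`,
the Lagrangian `μ ↦ ε(μ) + ∫⟨F,Φ'⟩dμ + 2θ(∫(u,f)dμ − ε(μ))` is lower semicontinuous on the probability
measures carried by `S ∩ {|u|² ≤ ρ}` with mean enstrophy `≤ C < ∞`: the sibling's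
`lagrangian_lowerSemicontinuous` (fed with the landed `stub_lscEnstrophy`) composed with the
continuous inclusion `X_S ↪ X` (hypothesis (i) of Fan 1953, Thm 2). [folklore] -/
theorem lagrangian_lowerSemicontinuous_on {ν : ℝ} (hν : 0 < ν)
    {f : UnitAddTorus (Fin 3) → EuclideanSpace ℝ (Fin 3)} (hf : MemLp f 2 volume) (S : Set (Torus.energySpace (Fin 3)))
    (ρ : ℝ) {C : ℝ≥0∞} (hC : C ≠ ⊤) (Φ : Torus.CylindricalTest (Fin 3)) {θ : ℝ} (hθ : θ ≤ 0) :
    LowerSemicontinuous fun x : {μ : ProbabilityMeasure (Torus.energySpace (Fin 3)) |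
        (∀ᵐ u ∂(μ : Measure (Torus.energySpace (Fin 3))), ‖u‖ ^ 2 ≤ ρ) ∧ (∀ᵐ u ∂(μ : Measure (Torus.energySpace (Fin 3))), u ∈ S) ∧
          Torus.ensembleEnstrophy (μ : Measure (Torus.energySpace (Fin 3))) ≤ C} =>
      Torus.ensembleDissipation ν ((x : ProbabilityMeasure (Torus.energySpace (Fin 3))) : Measure (Torus.energySpace (Fin 3))) +
        ∫ u, Torus.nsGeneratorPairing ν f u (Φ.grad u) ∂((x : ProbabilityMeasure (Torus.energySpace (Fin 3))) : Measure (Torus.energySpace (Fin 3))) +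
        2 * θ * ((∫ u, Torus.pairing u.1 f ∂((x : ProbabilityMeasure (Torus.energySpace (Fin 3))) : Measure (Torus.energySpace (Fin 3)))) -
          Torus.ensembleDissipation ν ((x : ProbabilityMeasure (Torus.energySpace (Fin 3))) : Measure (Torus.energySpace (Fin 3)))) := by
  have hsub : {μ : ProbabilityMeasure (Torus.energySpace (Fin 3)) |
        (∀ᵐ u ∂(μ : Measure (Torus.energySpace (Fin 3))), ‖u‖ ^ 2 ≤ ρ) ∧ (∀ᵐ u ∂(μ : Measure (Torus.energySpace (Fin 3))), u ∈ S) ∧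
          Torus.ensembleEnstrophy (μ : Measure (Torus.energySpace (Fin 3))) ≤ C} ⊆
      {μ : ProbabilityMeasure (Torus.energySpace (Fin 3)) |
        (∀ᵐ u ∂(μ : Measure (Torus.energySpace (Fin 3))), ‖u‖ ^ 2 ≤ ρ) ∧ Torus.ensembleEnstrophy (μ : Measure (Torus.energySpace (Fin 3))) ≤ C} :=
    fun μ hμ => ⟨hμ.1, hμ.2.2⟩
  exact (lagrangian_lowerSemicontinuous stub_lscEnstrophy hν hf ρ hC Φ hθ).comp
    (continuous_inclusion hsub)

/-- **Ky Fan's theorem applied to the Lagrangian game on `X_S`** — the dissipation sublevel set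
`X_S = {μ : μ-a.e. |u|² ≤ ρ, μ-a.e. u ∈ S, ∫⁻‖∇u‖² ≤ C}` (compact by hypothesis) against the slope-`L`
multipliers `Y_L` (nonempty: the flat test): if every `μ ∈ X_S` is beaten above `M` by some multiplier,
ONE multiplier beats all of `X_S` above `M` (Ky Fan, PNAS 39 (1953) 42–47, Thm 2 = `stub_fanMinimax`).
[folklore] -/
theorem fan_game_on {ν : ℝ} (hν : 0 < ν) {f : UnitAddTorus (Fin 3) → EuclideanSpace ℝ (Fin 3)}
    (hf : MemLp f 2 volume) {L : ℝ} (hL : 0 ≤ L) (S : Set (Torus.energySpace (Fin 3))) (ρ M : ℝ) {C : ℝ≥0∞} (hC : C ≠ ⊤)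
    (hcpt : IsCompact {μ : ProbabilityMeasure (Torus.energySpace (Fin 3)) |
        (∀ᵐ u ∂(μ : Measure (Torus.energySpace (Fin 3))), ‖u‖ ^ 2 ≤ ρ) ∧ (∀ᵐ u ∂(μ : Measure (Torus.energySpace (Fin 3))), u ∈ S) ∧
          Torus.ensembleEnstrophy (μ : Measure (Torus.energySpace (Fin 3))) ≤ C})
    (hpt : ∀ μ : ProbabilityMeasure (Torus.energySpace (Fin 3)),
      μ ∈ {μ : ProbabilityMeasure (Torus.energySpace (Fin 3)) |
        (∀ᵐ u ∂(μ : Measure (Torus.energySpace (Fin 3))), ‖u‖ ^ 2 ≤ ρ) ∧ (∀ᵐ u ∂(μ : Measure (Torus.energySpace (Fin 3))), u ∈ S) ∧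
          Torus.ensembleEnstrophy (μ : Measure (Torus.energySpace (Fin 3))) ≤ C} →
      ∃ (Φ : Torus.CylindricalTest (Fin 3)) (θ : ℝ),
        (-L ≤ θ ∧ θ ≤ 0 ∧
          ∀ u : (Torus.energySpace (Fin 3)), ‖u‖ ^ 2 ≤ ρ → |Torus.nsGeneratorPairing ν f u (Φ.grad u)| ≤ L) ∧
        M < Torus.ensembleDissipation ν (μ : Measure (Torus.energySpace (Fin 3))) +
          ∫ u, Torus.nsGeneratorPairing ν f u (Φ.grad u) ∂(μ : Measure (Torus.energySpace (Fin 3))) +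
          2 * θ * ((∫ u, Torus.pairing u.1 f ∂(μ : Measure (Torus.energySpace (Fin 3)))) -
            Torus.ensembleDissipation ν (μ : Measure (Torus.energySpace (Fin 3))))) :
    ∃ (Φ : Torus.CylindricalTest (Fin 3)) (θ : ℝ),
      (-L ≤ θ ∧ θ ≤ 0 ∧
        ∀ u : (Torus.energySpace (Fin 3)), ‖u‖ ^ 2 ≤ ρ → |Torus.nsGeneratorPairing ν f u (Φ.grad u)| ≤ L) ∧
      ∀ μ : ProbabilityMeasure (Torus.energySpace (Fin 3)),
        μ ∈ {μ : ProbabilityMeasure (Torus.energySpace (Fin 3)) |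
          (∀ᵐ u ∂(μ : Measure (Torus.energySpace (Fin 3))), ‖u‖ ^ 2 ≤ ρ) ∧ (∀ᵐ u ∂(μ : Measure (Torus.energySpace (Fin 3))), u ∈ S) ∧
            Torus.ensembleEnstrophy (μ : Measure (Torus.energySpace (Fin 3))) ≤ C} →
        M < Torus.ensembleDissipation ν (μ : Measure (Torus.energySpace (Fin 3))) +
          ∫ u, Torus.nsGeneratorPairing ν f u (Φ.grad u) ∂(μ : Measure (Torus.energySpace (Fin 3))) +
          2 * θ * ((∫ u, Torus.pairing u.1 f ∂(μ : Measure (Torus.energySpace (Fin 3)))) -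
            Torus.ensembleDissipation ν (μ : Measure (Torus.energySpace (Fin 3)))) := by
  haveI : CompactSpace {μ : ProbabilityMeasure (Torus.energySpace (Fin 3)) |
      (∀ᵐ u ∂(μ : Measure (Torus.energySpace (Fin 3))), ‖u‖ ^ 2 ≤ ρ) ∧ (∀ᵐ u ∂(μ : Measure (Torus.energySpace (Fin 3))), u ∈ S) ∧
        Torus.ensembleEnstrophy (μ : Measure (Torus.energySpace (Fin 3))) ≤ C} :=
    isCompact_iff_compactSpace.1 hcpt
  -- the multipliers `Y_L` are nonempty: the flat test with `θ = 0`
  obtain ⟨Φz, hΦz⟩ := exists_flat_test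
  have hz : ∀ u : (Torus.energySpace (Fin 3)), Torus.nsGeneratorPairing ν f u (Φz.grad u) = 0 :=
    hΦz ν f (hf.integrable one_le_two)
  haveI : Nonempty {p : Torus.CylindricalTest (Fin 3) × ℝ // -L ≤ p.2 ∧ p.2 ≤ 0 ∧
      ∀ u : (Torus.energySpace (Fin 3)), ‖u‖ ^ 2 ≤ ρ → |Torus.nsGeneratorPairing ν f u (p.1.grad u)| ≤ L} :=
    ⟨⟨(Φz, 0), by linarith, le_rfl, fun u _ => by rw [hz u, abs_zero]; exact hL⟩⟩
  -- Ky Fan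
  obtain ⟨y₀, hy₀⟩ := stub_fanMinimax _ _
    (fun (x : {μ : ProbabilityMeasure (Torus.energySpace (Fin 3)) |
        (∀ᵐ u ∂(μ : Measure (Torus.energySpace (Fin 3))), ‖u‖ ^ 2 ≤ ρ) ∧ (∀ᵐ u ∂(μ : Measure (Torus.energySpace (Fin 3))), u ∈ S) ∧
          Torus.ensembleEnstrophy (μ : Measure (Torus.energySpace (Fin 3))) ≤ C})
      (y : {p : Torus.CylindricalTest (Fin 3) × ℝ // -L ≤ p.2 ∧ p.2 ≤ 0 ∧
        ∀ u : (Torus.energySpace (Fin 3)), ‖u‖ ^ 2 ≤ ρ → |Torus.nsGeneratorPairing ν f u (p.1.grad u)| ≤ L}) =>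
      Torus.ensembleDissipation ν ((x : ProbabilityMeasure (Torus.energySpace (Fin 3))) : Measure (Torus.energySpace (Fin 3))) +
        ∫ u, Torus.nsGeneratorPairing ν f u (y.1.1.grad u) ∂((x : ProbabilityMeasure (Torus.energySpace (Fin 3))) : Measure (Torus.energySpace (Fin 3))) +
        2 * y.1.2 * ((∫ u, Torus.pairing u.1 f ∂((x : ProbabilityMeasure (Torus.energySpace (Fin 3))) : Measure (Torus.energySpace (Fin 3)))) -
          Torus.ensembleDissipation ν ((x : ProbabilityMeasure (Torus.energySpace (Fin 3))) : Measure (Torus.energySpace (Fin 3)))))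
    (fun y => lagrangian_lowerSemicontinuous_on hν hf S ρ hC y.1.1 y.2.2.1)
    (fun x₁ x₂ t ht0 ht1 => by
      obtain ⟨μ₀, hμ₀, hLag⟩ := fan_convex_on (ν := ν) hf S ρ hC x₁.1 x₂.1 x₁.2 x₂.2 ht0 ht1
      exact ⟨⟨μ₀, hμ₀⟩, fun y => (hLag y.1.1 y.1.2).le⟩)
    (fun y₁ y₂ t ht0 ht1 => by
      obtain ⟨Φ₀, θ₀, hy, hLag⟩ :=
        fan_concave stub_cylindricalCombination ν hf ρ y₁.2 y₂.2 ht0 ht1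
      exact ⟨⟨(Φ₀, θ₀), hy⟩, fun x => (hLag _ inferInstance x.2.1).ge⟩)
    M
    (fun x => by
      obtain ⟨Φ, θ, hy, hlt⟩ := hpt x.1 x.2
      exact ⟨⟨(Φ, θ), hy⟩, hlt⟩)
  exact ⟨y₀.1.1, y₀.1.2, y₀.2, fun μ hμ => hy₀ ⟨μ, hμ⟩⟩

/-- **The minimax alternative on the constrained dissipation sublevel set `X_S`** (strong duality in
mean form): EITHER one slope-`L` multiplier makes the Lagrangian `> M` at every probability measure
carried by `S ∩ {|u|² ≤ ρ}` with mean enstrophy `≤ C`, OR some such measure is `(L, M)`-approximately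
relaxed (mean dissipation `≤ M` and Lagrangian `≤ M` against every slope-`L` multiplier). The flat
multiplier turns `ε(μ) > M` into a beating multiplier; then `fan_game_on`. [folklore] -/
theorem alternative_on_sublevel_on {ν : ℝ} (hν : 0 < ν)
    {f : UnitAddTorus (Fin 3) → EuclideanSpace ℝ (Fin 3)} (hf : MemLp f 2 volume) {L : ℝ} (hL : 0 ≤ L)
    (S : Set (Torus.energySpace (Fin 3))) (ρ M : ℝ) {C : ℝ≥0∞} (hC : C ≠ ⊤)
    (hcpt : IsCompact {μ : ProbabilityMeasure (Torus.energySpace (Fin 3)) |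
        (∀ᵐ u ∂(μ : Measure (Torus.energySpace (Fin 3))), ‖u‖ ^ 2 ≤ ρ) ∧ (∀ᵐ u ∂(μ : Measure (Torus.energySpace (Fin 3))), u ∈ S) ∧
          Torus.ensembleEnstrophy (μ : Measure (Torus.energySpace (Fin 3))) ≤ C}) :
    (∃ (Φ : Torus.CylindricalTest (Fin 3)) (θ : ℝ), -L ≤ θ ∧ θ ≤ 0 ∧
        (∀ u : (Torus.energySpace (Fin 3)), ‖u‖ ^ 2 ≤ ρ → |Torus.nsGeneratorPairing ν f u (Φ.grad u)| ≤ L) ∧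
        ∀ μ : Measure (Torus.energySpace (Fin 3)), IsProbabilityMeasure μ → (∀ᵐ u ∂μ, ‖u‖ ^ 2 ≤ ρ) → (∀ᵐ u ∂μ, u ∈ S) →
          Torus.ensembleEnstrophy μ ≤ C →
          M < Torus.ensembleDissipation ν μ + ∫ u, Torus.nsGeneratorPairing ν f u (Φ.grad u) ∂μ +
            2 * θ * ((∫ u, Torus.pairing u.1 f ∂μ) - Torus.ensembleDissipation ν μ)) ∨
      ∃ μ : Measure (Torus.energySpace (Fin 3)), IsProbabilityMeasure μ ∧ (∀ᵐ u ∂μ, ‖u‖ ^ 2 ≤ ρ) ∧ (∀ᵐ u ∂μ, u ∈ S) ∧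
        Torus.ensembleEnstrophy μ < ⊤ ∧
        Integrable (fun u : (Torus.energySpace (Fin 3)) => Torus.pairing u.1 f) μ ∧
        (∀ Φ : Torus.CylindricalTest (Fin 3),
          Integrable (fun u => Torus.nsGeneratorPairing ν f u (Φ.grad u)) μ) ∧
        Torus.ensembleDissipation ν μ ≤ M ∧
        ∀ (Φ : Torus.CylindricalTest (Fin 3)) (θ : ℝ), -L ≤ θ → θ ≤ 0 →
          (∀ u : (Torus.energySpace (Fin 3)), ‖u‖ ^ 2 ≤ ρ → |Torus.nsGeneratorPairing ν f u (Φ.grad u)| ≤ L) →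
          Torus.ensembleDissipation ν μ + ∫ u, Torus.nsGeneratorPairing ν f u (Φ.grad u) ∂μ +
              2 * θ * ((∫ u, Torus.pairing u.1 f ∂μ) - Torus.ensembleDissipation ν μ) ≤ M := by
  rw [or_iff_not_imp_right]
  intro hno
  obtain ⟨Φz, hΦz⟩ := exists_flat_test
  have hf1 : Integrable f volume := hf.integrable one_le_two
  have hz : ∀ u : (Torus.energySpace (Fin 3)), Torus.nsGeneratorPairing ν f u (Φz.grad u) = 0 := hΦz ν f hf1
  -- every `μ ∈ X_S` is beaten above `M`
  have hpt : ∀ μ : ProbabilityMeasure (Torus.energySpace (Fin 3)),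
      μ ∈ {μ : ProbabilityMeasure (Torus.energySpace (Fin 3)) |
        (∀ᵐ u ∂(μ : Measure (Torus.energySpace (Fin 3))), ‖u‖ ^ 2 ≤ ρ) ∧ (∀ᵐ u ∂(μ : Measure (Torus.energySpace (Fin 3))), u ∈ S) ∧
          Torus.ensembleEnstrophy (μ : Measure (Torus.energySpace (Fin 3))) ≤ C} →
      ∃ (Φ : Torus.CylindricalTest (Fin 3)) (θ : ℝ),
        (-L ≤ θ ∧ θ ≤ 0 ∧
          ∀ u : (Torus.energySpace (Fin 3)), ‖u‖ ^ 2 ≤ ρ → |Torus.nsGeneratorPairing ν f u (Φ.grad u)| ≤ L) ∧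
        M < Torus.ensembleDissipation ν (μ : Measure (Torus.energySpace (Fin 3))) +
          ∫ u, Torus.nsGeneratorPairing ν f u (Φ.grad u) ∂(μ : Measure (Torus.energySpace (Fin 3))) +
          2 * θ * ((∫ u, Torus.pairing u.1 f ∂(μ : Measure (Torus.energySpace (Fin 3)))) -
            Torus.ensembleDissipation ν (μ : Measure (Torus.energySpace (Fin 3)))) := by
    intro μ hμ
    by_contra hcon
    push Not at hcon
    have hiw : Integrable (fun u : (Torus.energySpace (Fin 3)) => Torus.pairing u.1 f) (μ : Measure (Torus.energySpace (Fin 3))) :=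
      integrable_of_ball (Torus.continuous_pairing_coe hf) (abs_pairing_growth hf) _ hμ.1
    have hig : ∀ Φ : Torus.CylindricalTest (Fin 3),
        Integrable (fun u => Torus.nsGeneratorPairing ν f u (Φ.grad u)) (μ : Measure (Torus.energySpace (Fin 3))) := by
      intro Φ
      obtain ⟨K, hK⟩ := abs_nsGeneratorPairing_grad_growth ν hf Φ
      exact integrable_of_ball (Torus.continuous_nsGeneratorPairing_grad ν hf1 Φ) hK _ hμ.1
    have hD : Torus.ensembleDissipation ν (μ : Measure (Torus.energySpace (Fin 3))) ≤ M := by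
      have h := hcon Φz 0 ⟨by linarith, le_rfl, fun u _ => by rw [hz u, abs_zero]; exact hL⟩
      simpa [hz] using h
    exact hno ⟨(μ : Measure (Torus.energySpace (Fin 3))), inferInstance, hμ.1, hμ.2.1, lt_of_le_of_lt hμ.2.2 hC.lt_top, hiw,
      hig, hD, fun Φ θ h1 h2 h3 => hcon Φ θ ⟨h1, h2, h3⟩⟩
  obtain ⟨Φ, θ, ⟨hθL, hθ0, hslope⟩, hbeat⟩ := fan_game_on hν hf hL S ρ M hC hcpt hpt
  exact ⟨Φ, θ, hθL, hθ0, hslope, fun μ hμ hball hS hE => hbeat ⟨μ, hμ⟩ ⟨hball, hS, hE⟩⟩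

/-! ## The stub -/

/-- **S1b `stub_minimaxAlternativeOn`** — THE MINIMAX ALTERNATIVE WITH SLOPE-BOUNDED MULTIPLIERS ON
`S ∩ ball` (= sibling `stub_minimaxAlternative` with the game set
`X = {μ : μ-a.e. |u|² ≤ ρ, ∫⁻‖∇u‖² ≤ C}` replaced by `X_S = X ∩ {μ : μ-a.e. u ∈ S}`, whose compactness is
the hypothesis). For `ν > 0`, a radius `ρ`, smooth `f`, slope `L ≥ 0`, level `γ`, slack `η > 0`: EITHER
some multiplier `(Φ, θ)` with `−L ≤ θ ≤ 0` and `|⟨F(u),Φ'(u)⟩| ≤ L` on the ball certifies the floor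
`γ − η` at every finite-enstrophy state of `S ∩ ball`, OR an `(L, γ + η)`-approximately relaxed statistic
carried by `S ∩ ball` exists. Proof: with `F = ‖f‖_{L²}`, `c = L(1 + 2√ρF) + |γ| + η + 1`, run
`alternative_on_sublevel_on` on `X_S` with `C = c/ν` at level `M = γ + η`; its second horn is the second
disjunct verbatim; its first horn gives a slope-`L` multiplier beating `X_S` above `γ + η`, whence the
floor `γ − η` at every finite-enstrophy state of `S ∩ ball`: Dirac masses `δ_u ∈ X_S` when
`ν‖∇u‖² ≤ c` (`lagrangian_dirac`, `ae_dirac_of`), and the tail `ν‖∇u‖² > c` pays by itself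
(`tail_estimate`). [Fan, PNAS 39 (1953) Thm 2; FMRTTurbulence2001 IV §1.2] [folklore] -/
theorem stub_minimaxAlternativeOn :
    ∀ (S : Set (Torus.energySpace (Fin 3))),
      (∀ (ρ : ℝ) (c : ℝ≥0∞), c ≠ ⊤ →
        IsCompact {μ : ProbabilityMeasure (Torus.energySpace (Fin 3)) |
          (∀ᵐ u ∂(μ : Measure (Torus.energySpace (Fin 3))), ‖u‖ ^ 2 ≤ ρ) ∧
            (∀ᵐ u ∂(μ : Measure (Torus.energySpace (Fin 3))), u ∈ S) ∧
            Torus.ensembleEnstrophy (μ : Measure (Torus.energySpace (Fin 3))) ≤ c}) →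
      ∀ (ν ρ : ℝ) (f : UnitAddTorus (Fin 3) → EuclideanSpace ℝ (Fin 3)), 0 < ν → Torus.IsSmooth f →
      ∀ (L γ η : ℝ), 0 ≤ L → 0 < η →
        (∃ (Φ : Torus.CylindricalTest (Fin 3)) (θ : ℝ), -L ≤ θ ∧ θ ≤ 0 ∧
            (∀ u : Torus.energySpace (Fin 3), ‖u‖ ^ 2 ≤ ρ →
              |Torus.nsGeneratorPairing ν f u (Φ.grad u)| ≤ L) ∧
            ∀ u : Torus.energySpace (Fin 3), u ∈ S →
              Torus.eGradNormSq (u.1 : UnitAddTorus (Fin 3) → EuclideanSpace ℝ (Fin 3)) ≠ ⊤ →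
              ‖u‖ ^ 2 ≤ ρ →
                γ - η ≤ ν * (Torus.eGradNormSq (u.1 : UnitAddTorus (Fin 3) → EuclideanSpace ℝ (Fin 3))).toReal +
                  Torus.nsGeneratorPairing ν f u (Φ.grad u) +
                  2 * θ * (Torus.pairing u.1 f -
                    ν * (Torus.eGradNormSq (u.1 : UnitAddTorus (Fin 3) → EuclideanSpace ℝ (Fin 3))).toReal)) ∨
          ∃ μ : Measure (Torus.energySpace (Fin 3)), IsProbabilityMeasure μ ∧
            (∀ᵐ u ∂μ, ‖u‖ ^ 2 ≤ ρ) ∧ (∀ᵐ u ∂μ, u ∈ S) ∧ Torus.ensembleEnstrophy μ < ⊤ ∧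
            Integrable (fun u : Torus.energySpace (Fin 3) => Torus.pairing u.1 f) μ ∧
            (∀ Φ : Torus.CylindricalTest (Fin 3),
              Integrable (fun u => Torus.nsGeneratorPairing ν f u (Φ.grad u)) μ) ∧
            Torus.ensembleDissipation ν μ ≤ γ + η ∧
            ∀ (Φ : Torus.CylindricalTest (Fin 3)) (θ : ℝ), -L ≤ θ → θ ≤ 0 →
              (∀ u : Torus.energySpace (Fin 3), ‖u‖ ^ 2 ≤ ρ →
                |Torus.nsGeneratorPairing ν f u (Φ.grad u)| ≤ L) →
              Torus.ensembleDissipation ν μ + ∫ u, Torus.nsGeneratorPairing ν f u (Φ.grad u) ∂μ +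
                  2 * θ * ((∫ u, Torus.pairing u.1 f ∂μ) - Torus.ensembleDissipation ν μ) ≤ γ + η := by
  intro S hcpt ν ρ f hν hfs L γ η hL hη
  have hf : MemLp f 2 volume := hfs.memLp 2
  -- the constant `c = L(1 + 2√ρ‖f‖) + |γ| + η + 1 > 0` splitting Diracs from the tail
  obtain ⟨c, hc0, hcle⟩ : ∃ c : ℝ, 0 < c ∧
      L * (1 + 2 * (Real.sqrt ρ * ‖hf.toLp f‖)) + |γ| + η + 1 ≤ c := by
    refine ⟨_, ?_, le_rfl⟩
    have h1 : 0 ≤ L * (1 + 2 * (Real.sqrt ρ * ‖hf.toLp f‖)) := by positivity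
    have h2 := abs_nonneg γ
    linarith
  have hC : ENNReal.ofReal (c / ν) ≠ ⊤ := ENNReal.ofReal_ne_top
  rcases alternative_on_sublevel_on hν hf hL S ρ (γ + η) hC (hcpt ρ _ hC) with
    ⟨Φ, θ, hθL, hθ0, hslope, hbeat⟩ | hright
  · refine Or.inl ⟨Φ, θ, hθL, hθ0, hslope, fun u hu hfin hball => ?_⟩
    rcases le_or_gt (ν * (Torus.eGradNormSq (u.1 : UnitAddTorus (Fin 3) → EuclideanSpace ℝ (Fin 3))).toReal) c
      with hle | hlt
    · -- the Dirac mass `δ_u` lies in `X_S`: the multiplier beats it above `γ + η`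
      have hE : Torus.ensembleEnstrophy (Measure.dirac u) ≤ ENNReal.ofReal (c / ν) := by
        rw [ensembleEnstrophy_dirac, ← ENNReal.ofReal_toReal hfin]
        refine ENNReal.ofReal_le_ofReal ?_
        rw [le_div_iff₀ hν, mul_comm]
        exact hle
      have h := hbeat (Measure.dirac u) inferInstance (ae_dirac_of hball) (ae_dirac_of hu) hE
      rw [lagrangian_dirac] at h
      linarith
    · -- the tail `ν‖∇u‖² > c` pays by itself
      exact tail_estimate hL hη.le hθL hθ0 (hslope u hball) (abs_pairing_le_of_ball hf hball)
        (by positivity) hlt hcle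
  · exact Or.inr hright

end Summit.AnomalousDissipation.AnomalousDissipation.Theorems.PumpedMirrorMirrorFloorTG

end
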